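import Summits.AnomalousDissipation.AnomalousDissipation.Theorems.SawtoothPulseCascadeK1LocalisedCascadeSlabEnergy

/-!
# K1loc, line `Spectral` — S-D (first good piece): A CERTIFIED INSTANCE OF THE R1 INEQUALITIES

Helper file of the prover lane on the crux `K1LocalisedCascade` (stmt-AnomalousDissipation-19491), route
`SawtoothPulseCascade`, registered line `Cruxes.K1LocalisedCascade.Spectral` (one open stub `stub_highModeConcentration`).
`…SlabEnergy.sqrt_lowModes_le_firstGoodPiece_slab` takes the R1 inequalities as hypotheses; this file DISCHARGES them for one cascade,
`P = (γ, δ₀, d, N₀, ρN) = (5, 1/256, 2, 1, 2)` at depth `i₀ = n = 2`, with `M₂ = 7`, `M₁ = 8`, `M₃ = 9`, `E_V = 10⁻⁶`, `E_H = 10⁻⁵`,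
`B = (1/484, 7/100, 24/25)` and the bare column as start symbol (`K = 0`), and evaluates the bound: `q₀² = Γ ≤ 0.203`
(memo v8 §9.1 row (5, 2, 2, 1/256): Γ ≈ 0.20).  So the symbolic lemma is not vacuous, and for the restated box point `(5, 2)` with
`δ₀ = 1/256` the ledger's `hstart` holds at `i₀ = 2` with `q₀ = √0.203 ≈ 0.45 < ‖θ₀‖ = 1/√2`.

* `hstart_box52` — the statement above.

[cite: ElgindiLissMattingly2025, §1.2.2, §3.1] [cite: DEIJ2022, (1.2)–(1.3)] [problem: turb]
-/

-- `Summit.<Summit>.<Problem>`: single-conjunct summit, the duplicate namespace segment is deliberate.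
set_option linter.dupNamespace false

noncomputable section

namespace Summit.AnomalousDissipation.AnomalousDissipation.Theorems.SawtoothPulseCascade.K1Start

open Set Function MeasureTheory UnitAddTorus
open scoped ENNReal
open Literature.Analysis Literature.Analysis.FunctionSpaces Literature.Analysis.FunctionSpaces.Torus
open Literature.Analysis.FluidPDE.ShearStage
open Literature.Analysis.FluidPDE.SawtoothCascade Literature.Analysis.FluidPDE.SawtoothCascade.CascadeParams

/-- `2e^{−7²/2} ≤ 2·10⁻¹⁰` (`e > 2.7`). [folklore] -/
theorem two_mul_exp_neg_le : 2 * Real.exp (-(7 ^ 2 / 2 : ℝ)) ≤ 2 / 10 ^ 10 := by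
  have h1 : Real.exp (-(7 ^ 2 / 2 : ℝ)) ≤ Real.exp (-24) := Real.exp_le_exp.mpr (by norm_num)
  have h2 : Real.exp (24 : ℝ) = Real.exp 1 ^ 24 := by
    rw [Real.exp_one_pow 24]; norm_num
  have h3 : (2.7 : ℝ) ^ 24 ≤ Real.exp 24 := by
    rw [h2]; exact pow_le_pow_left₀ (by norm_num) (le_of_lt (lt_trans (by norm_num) Real.exp_one_gt_d9)) 24
  have h4 : Real.exp (-(7 ^ 2 / 2 : ℝ)) ≤ 1 / 10 ^ 10 :=
    calc _ ≤ Real.exp (-24) := h1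
      _ = (Real.exp 24)⁻¹ := Real.exp_neg 24
      _ ≤ ((2.7 : ℝ) ^ 24)⁻¹ := inv_anti₀ (by positivity) h3
      _ ≤ 1 / 10 ^ 10 := by norm_num
  linarith

section Cascade

variable (P : CascadeParams)

/-- **A certified instance of the first good piece** at the box point `(γ, ρN) = (5, 2)` restated with `δ₀ = 1/256` (`d = 2`,
`N₀ = 1`), depth `i₀ = 2`, start symbol supported on the column `{k₀ = 0}`: for every `κ ∈ (0, κ₁]` and every classical cascade scalar `w`
from the datum, `√(Σ' μ(k)²|𝓕(w(tStart 2))(k)|²) ≤ √0.203 + √(2π√(1+(1+γ)²)(1+γ)⁴ √(2κ₁·tStart 2·‖datum‖²))`.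
[cite: ElgindiLissMattingly2025, §1.2.2, §3.1] [cite: DEIJ2022, (1.2)–(1.3)] -/
theorem hstart_box52 (hP : P = ⟨5, 1 / 256, 2, 1, 2⟩) (hδ₀ : 0 < P.δ₀) (hd : 0 < P.d)
    (a b : ℕ → UnitAddTorus (Fin 2) → ℝ) (has : ∀ j, IsSmooth (a j)) (h0 : a 0 = datum)
    (hb : ∀ j, b j = a j ∘ shearMap 0 1 (amp ⟨P.U j, P.U_periodic j, P.contDiff_U (P.δ_pos hδ₀ hd j)⟩ P.γ))
    (hab : ∀ j, a (j + 1) = b j ∘ shearMap 1 0 (amp ⟨P.U j, P.U_periodic j, P.contDiff_U (P.δ_pos hδ₀ hd j)⟩ P.γ))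
    (μ : (Fin 2 → ℤ) → ℝ) (hμ1 : ∀ k, |μ k| ≤ 1) (hμ : ∀ k, (0 : ℤ) < |k 0| → μ k = 0) {κ₁ : ℝ} :
    ∀ κ ∈ Ioc (0 : ℝ) κ₁, ∀ w : ℝ → UnitAddTorus (Fin 2) → ℝ,
      FluidPDE.Torus.IsClassicalScalarTransportOn (Ico 0 1) κ P.field w → w 0 = datum →
        Real.sqrt (∑' k, μ k ^ 2 * ‖mFourierCoeff (fun x => (w (tStart 2) x : ℂ)) k‖ ^ 2) ≤
          Real.sqrt (203 / 1000) +
          Real.sqrt (2 * Real.pi * Real.sqrt (1 + (1 + P.γ) ^ 2) * (1 + P.γ) ^ (2 * 2) *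
            Real.sqrt (2 * κ₁ * tStart 2 * FluidPDE.Torus.scalarL2Sq datum)) := by
  -- the parameters
  have hγ5 : P.γ = 5 := by rw [hP]
  have hδ : P.δ₀ = 1 / 256 := by rw [hP]
  have hdd : P.d = 2 := by rw [hP]
  have hN0 : P.N₀ = 1 := by rw [hP]
  have hρ2 : P.ρN = 2 := by rw [hP]
  have hNj : ∀ j, (P.N j : ℝ) = 2 ^ j := fun j => by rw [CascadeParams.N, hN0, hρ2]; push_cast; ring
  have hδj : ∀ j, P.δ j = 1 / 256 / 2 ^ j := fun j => by rw [CascadeParams.δ, hδ, hdd]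
  have hπ3 : (3.14 : ℝ) < Real.pi := Real.pi_gt_d2
  have hπ4 : Real.pi < 3.15 := Real.pi_lt_d2
  have hπ := Real.pi_pos
  have hδle : ∀ j, P.δ j ≤ 1 / 256 := fun j => by
    rw [hδj]; exact div_le_self (by norm_num) (one_le_pow₀ (by norm_num))
  have hη := two_mul_exp_neg_le
  have hη0 : (0 : ℝ) ≤ 2 * Real.exp (-(7 ^ 2 / 2 : ℝ)) := by positivity
  -- the zone inequalities: `10⁻⁵ ≤ δ_j/(2πN_j)` for `j < 2`
  have hzone : ∀ j, j < 2 → (1 / 10 ^ 5 : ℝ) ≤ P.δ j / (2 * Real.pi * P.N j) := by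
    intro j hj
    rw [le_div_iff₀ (by rw [hNj]; positivity), hδj, hNj]
    interval_cases j <;> norm_num <;> nlinarith [hπ4]
  -- the component length factor `c_j ≤ 1/2`
  have hc : ∀ j, 1 / (2 * (P.N j : ℝ)) - 7 * P.δ j / (Real.pi * P.N j) ≤ 1 / 2 := by
    intro j
    have h1 : 1 / (2 * (P.N j : ℝ)) ≤ 1 / 2 := by
      rw [hNj]; exact div_le_div_of_nonneg_left (by norm_num) (by norm_num) (by linarith [one_le_pow₀ (by norm_num : (1:ℝ) ≤ 2) (n := j)])
    have h2 : 0 ≤ 7 * P.δ j / (Real.pi * P.N j) := by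
      have := P.δ_pos hδ₀ hd j; rw [hNj]; positivity
    linarith
  have hres := sqrt_lowModes_le_firstGoodPiece_slab P (by rw [hγ5]; norm_num) (by rw [hγ5]; norm_num) hδ₀ hd
    (by rw [hN0]) (by rw [hρ2]; norm_num) (M₁ := 8) (M₂ := 7) (by norm_num) (by norm_num)
    (fun j => by linarith [hδle j]) (n := 2) a b has h0 hb hab (EV := 1 / 10 ^ 6) (EH := 1 / 10 ^ 5)
    (fun ℓ => if ℓ = 0 then (1 / 484 : ℝ) else if ℓ = 1 then 7 / 100 else 24 / 25) (by norm_num)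
    ?hEV ?hEH ?hζV ?hζH ?hB0 ?hB (M₃ := 9) (by norm_num) (fun j => by linarith [hδle j]) ?hV3 ?hH3
    μ hμ1 (K := 0) (by rw [hγ5]; norm_num) (fun k hk => hμ k (by exact_mod_cast hk)) (κ₁ := κ₁)
  case hEV =>
    intro ℓ hℓ
    rw [hγ5]
    have hterm : ∀ i ∈ Finset.range ℓ, (1 + (5 : ℝ) + 5 ^ 2) ^ i *
        ((5 ^ 2 * (1 / (2 * (P.N (2 - ℓ + i) : ℝ)) - 7 * P.δ (2 - ℓ + i) / (Real.pi * P.N (2 - ℓ + i))) +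
          5 * (1 / (2 * (P.N (2 - ℓ + i) : ℝ)) - 7 * P.δ (2 - ℓ + i) / (Real.pi * P.N (2 - ℓ + i)))) *
          (2 * Real.exp (-(7 ^ 2 / 2)))) ≤ 31 ^ i * (15 * (2 / 10 ^ 10)) := by
      intro i _
      have hci := hc (2 - ℓ + i)
      have h1 : (5 ^ 2 * (1 / (2 * (P.N (2 - ℓ + i) : ℝ)) - 7 * P.δ (2 - ℓ + i) / (Real.pi * P.N (2 - ℓ + i))) +
          5 * (1 / (2 * (P.N (2 - ℓ + i) : ℝ)) - 7 * P.δ (2 - ℓ + i) / (Real.pi * P.N (2 - ℓ + i)))) *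
          (2 * Real.exp (-(7 ^ 2 / 2))) ≤ 15 * (2 / 10 ^ 10) := by
        have h30 : (5 ^ 2 * (1 / (2 * (P.N (2 - ℓ + i) : ℝ)) - 7 * P.δ (2 - ℓ + i) / (Real.pi * P.N (2 - ℓ + i))) +
            5 * (1 / (2 * (P.N (2 - ℓ + i) : ℝ)) - 7 * P.δ (2 - ℓ + i) / (Real.pi * P.N (2 - ℓ + i)))) ≤ 15 := by linarith
        calc _ ≤ 15 * (2 * Real.exp (-(7 ^ 2 / 2))) := mul_le_mul_of_nonneg_right h30 hη0
          _ ≤ 15 * (2 / 10 ^ 10) := mul_le_mul_of_nonneg_left hη (by norm_num)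
      have h31 : (1 + (5 : ℝ) + 5 ^ 2) ^ i = 31 ^ i := by norm_num
      rw [h31]
      exact mul_le_mul_of_nonneg_left h1 (by positivity)
    calc _ ≤ ∑ i ∈ Finset.range ℓ, (31 : ℝ) ^ i * (15 * (2 / 10 ^ 10)) := Finset.sum_le_sum hterm
      _ ≤ ∑ i ∈ Finset.range 2, (31 : ℝ) ^ i * (15 * (2 / 10 ^ 10)) :=
          Finset.sum_le_sum_of_subset_of_nonneg (Finset.range_mono hℓ) fun i _ _ => by positivity
      _ ≤ 1 / 10 ^ 6 := by simp only [Finset.sum_range_succ, Finset.sum_range_zero]; norm_num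
  case hEH =>
    rw [hγ5]
    nlinarith [hη, hη0]
  case hζV =>
    intro j hj
    have hz := hzone j hj
    have e : (8 : ℝ) * P.δ j / (2 * Real.pi * P.N j) = 7 * P.δ j / (2 * Real.pi * P.N j) + P.δ j / (2 * Real.pi * P.N j) := by
      ring
    rw [e]; linarith
  case hζH =>
    intro j hj
    have hz := hzone j hj
    have e : (8 : ℝ) * P.δ j / (2 * Real.pi * P.N j) = 7 * P.δ j / (2 * Real.pi * P.N j) + P.δ j / (2 * Real.pi * P.N j) := by
      ring
    rw [e]; linarith
  case hV3 =>
    intro j hj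
    have hz := hzone j hj
    have e : (9 : ℝ) * P.δ j / (2 * Real.pi * P.N j) = 8 * P.δ j / (2 * Real.pi * P.N j) + P.δ j / (2 * Real.pi * P.N j) := by
      ring
    rw [e]; linarith
  case hH3 =>
    intro j hj
    have hz := hzone j hj
    have e : (9 : ℝ) * P.δ j / (2 * Real.pi * P.N j) = 8 * P.δ j / (2 * Real.pi * P.N j) + P.δ j / (2 * Real.pi * P.N j) := by
      ring
    rw [e]; linarith
  case hB0 =>
    rw [hγ5]; norm_num
  case hB =>
    intro ℓ hℓ
    rw [hγ5]
    interval_cases ℓ <;> simp only [hNj] <;> norm_num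
  -- evaluate the bound
  refine fun κ hκ w hw hw0 => (hres κ hκ w hw hw0).trans (add_le_add (Real.sqrt_le_sqrt ?_) le_rfl)
  have hB2 : (if (2 : ℕ) = 0 then (1 / 484 : ℝ) else if (2 : ℕ) = 1 then 7 / 100 else 24 / 25) = 24 / 25 := by norm_num
  rw [hB2]
  have hC0 : (24 / 25 : ℝ) / Real.pi + 2 * Real.pi * (1 / 10 ^ 6) ≤ 3058 / 10000 := by
    have h1 : (24 / 25 : ℝ) / Real.pi ≤ (24 / 25) / 3.14 := div_le_div_of_nonneg_left (by norm_num) (by norm_num) hπ3.le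
    nlinarith [h1, hπ4]
  have hC0' : 0 ≤ (24 / 25 : ℝ) / Real.pi + 2 * Real.pi * (1 / 10 ^ 6) := by positivity
  have hVB : ∑ j ∈ Finset.range 2, 4 * (9 : ℝ) * P.δ j / Real.pi ≤ 672 / 10000 := by
    simp only [Finset.sum_range_succ, Finset.sum_range_zero, hδj]
    have h1 : (4 : ℝ) * 9 * (1 / 256 / 2 ^ 0) / Real.pi + 4 * 9 * (1 / 256 / 2 ^ 1) / Real.pi = (27 / 128) / Real.pi := by
      field_simp; ring
    rw [zero_add, h1]
    calc (27 / 128 : ℝ) / Real.pi ≤ (27 / 128) / 3.14 := div_le_div_of_nonneg_left (by norm_num) (by norm_num) hπ3.le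
      _ ≤ 672 / 10000 := by norm_num
  have hVB' : 0 ≤ ∑ j ∈ Finset.range 2, 4 * (9 : ℝ) * P.δ j / Real.pi :=
    Finset.sum_nonneg fun j _ => by have := P.δ_pos hδ₀ hd j; positivity
  have hK0 : (2 : ℝ) * ((0 : ℕ) : ℝ) = 0 := by norm_num
  rw [hK0, zero_mul, add_zero]
  calc _ ≤ (3058 / 10000 : ℝ) ^ 2 + (2 * (3058 / 10000) + 1) * (672 / 10000) := by gcongr
    _ ≤ 203 / 1000 := by norm_num

end Cascade

end Summit.AnomalousDissipation.AnomalousDissipation.Theorems.SawtoothPulseCascade.K1Start
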